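import Mathlib
import HarnessLib
import HarnessLib.Audit
import Summits.NavierStokesRegularity.Statement
import Literature.Analysis.FluidPDE.ClassicalSolution
import Literature.Analysis.FluidPDE.LerayHopf
import Literature.Analysis.FluidPDE.NSWave0
import Literature.Analysis.FluidPDE.LocalTypeI
import Literature.Analysis.FluidPDE.VectorCalculus
import Literature.Analysis.FluidPDE.Vorticity
import Literature.Analysis.FluidPDE.NSBoundedMildOseen
import Literature.Analysis.UnboundedOperators.HeatKernel
import Literature.Analysis.FluidPDE.SuitableWeak
import Literature.Analysis.FluidPDE.WeakSolution
import Summits.NavierStokesRegularity.NavierStokesRegularity.Theses.HalfSpaceWindowDoor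
import Summits.NavierStokesRegularity.NavierStokesRegularity.Theorems.FilamentPinchDoorSuitableHalfSpaceZoom
import HarnessLib.Audit.Status.Attr

/-!
Route: AxisTwistDoor

# Route AxisTwistDoor — Axis-twist door — a one-signed Type-I singularity must twist about its own
axis; tilt-dominated profiles are regular (Lei–Ren–Tian transfer)

It suffices to show X = the HALF-SPACE WINDOW DOOR leaf `HalfSpaceWindowDoor.Target` (rung
N0-LocalTubeDoorHalfSpace, label LocalTubeDoorHalfSpace; an EXISTING leaf, not Clay — no summit is
proved by this line): a classical Leray–Hopf solution, locally Type I at (x₀,T), whose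
scale-normalised vorticity component ⟪(T−t)·curl u, e⟫ has L²-fading negative part on every
similarity window, is backward bounded at (x₀,T). This line decides the leaf WITHOUT the poloidal
Liouville crux 19708 that both existing routes on the leaf need: after the energy-class zoom the
one-signed profile is attacked through the CIRCULATION Γ(r,z,s) of v around horizontal circles about
the vertical axis through the singular point — non-negative, non-decreasing in r and vanishing on
the axis by the sign — which obeys the axisymmetric swirl equation of
Koch–Nadirashvili–Seregin–Šverák EXACTLY up to a remainder bilinear in the non-axisymmetric
fluctuations; the dichotomy is: either the horizontal vorticity on axis-circles is dominated by the
vertical circulation density (then Lei–Ren–Tian's De Giorgi decay of the vorticity flux transfers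
and the apex is regular), or the counterexample twists about its own axis at all scales — and the
research crux says a one-signed filamentary singular profile cannot.
Lean: `Summit.NavierStokesRegularity.NavierStokesRegularity.Theses.HalfSpaceWindowDoor.Target`

## Assembly
Pure logic (kernel-checked in Sketch2.lean / glue.lean, no sorry): by contradiction
SuitableHalfSpaceZoom gives the energy-class one-signed backward-singular profile, FilamentaryGrowth
its growth constant; RotationToAxis reduces to e = e₃, where TiltDomination gives (K, M) and
AveragedConeLiouville says the profile is not backward singular — contradiction. No
PoloidalWindowRigidity (19708) is used. The deciding theorem is `closes (hZ : SuitableHalfSpaceZoom)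
(hF : FilamentaryGrowth) (hT : TiltDomination) (hA : AveragedConeLiouville) (hR : RotationToAxis) :
HalfSpaceWindowDoor.Target`.

CLOSES_TARGET: closes rung N0-LocalTubeDoorHalfSpace (DOOR) of NavierStokesRegularity: Summit.NavierStokesRegularity.NavierStokesRegularity.Theses.HalfSpaceWindowDoor.Target (D-0061; not the summit Statement) — the deciding theorem of this route concludes that registered leaf instead of the Statement decl `NavierStokesRegularity` (class rung: servable and labelled, never counted as concluding the summit Statement).

Rationale: WHY THIS LINE. Assume the opposite and build the singularity: zoom (energy class, shared support
SuitableHalfSpaceZoom = stmt-26432) to a Type-I ancient Oseen-mild suitable profile v, backward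
singular at (0,0), with ω₃ := ⟪curl v, e₃⟫ ≥ 0 after a rotation (support RotationToAxis), and with
linear signed-mass growth (shared crux FilamentaryGrowth = stmt-26431). TRANSFER WITH A DICTIONARY
from the solved siblings: KNSS (arXiv:0709.3599 §5: axisymmetric, Γ = r v_θ, ∂ₛΓ + b·∇Γ = ΔΓ −
(2/r)∂ᵣΓ, Liouville by Nash–Moser at the axis) and Lei–Ren–Tian (arXiv:2501.08976 Thm 1.1, §3–4:
non-symmetric, pointwise double-cone |ω_h| ≤ C|ω₃| + M, control of local vorticity fluxes through
discs/circles about the axis + De Giorgi decay of the absolute flux of the Type-I ancient limit;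
their Rem. 1.3 names the half-space case ω₃ ≥ 0 as OPEN even axisymmetric-free). Dictionary: r v_θ ↦
Γ(r,z,s) = ∮_(S(r,z)) v·τ dl = ∫_(D(r,z)) ω₃ (≥ 0, ↑ in r, = 0 on the axis by the SIGN — this
monotonicity is what neither sibling had); (b_r, b_z) ↦ the circle-averaged meridional velocity
(still divergence-free axisymmetrically); the identities ∮ω₃ dl = ∂ᵣΓ, ∮ω_r dl = −∂_zΓ, ∮Δv·dl =
∂ᵣᵣΓ − r⁻¹∂ᵣΓ + ∂_zzΓ hold with NO symmetry, so Γ solves KNSS's equation with the remainder ℛ =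
∮[(v_z − v̄_z)ω_r − (v_r − v̄_r)ω₃] dl; by the sign the ω₃-half of ℛ is a Type-I drift term for free
(|∮(v_r−v̄_r)ω₃| ≤ 2‖v(s)‖_∞ ∂ᵣΓ), and the ω_r-half is one as soon as ∮|ω_h| dl ≤ K∮ω₃ dl + M r
(TILT DOMINATION, the circle-averaged cone condition with LRT's slack) — then Γ has an "almost
divergence-free" Type-I drift, LRT's De Giorgi decay at the axis applies, and ε-regularity makes the
apex regular (crux AveragedConeLiouville, the transferred theorem, size L). The first
non-transferring step is the research crux TiltDomination: the one-signed filamentary counterexample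
must TWIST — carry horizontal vorticity on circles about its own singular axis far in excess of its
vertical circulation density — at all scales down to the apex; the energy class says it is a NECK of
parabolic size (circulation ≥ c on radii ρ₀<r<R at a height costs kinetic energy c² log(R/ρ₀)/2π
there, against the slice Morrey bound 2𝐈R — idea-crit-4's P2, typed as the first provable stub of
the crux skeleton), which is the quasi-self-similar regime where tilt domination is the expected
behaviour. Imported area: parabolic De Giorgi–Nash–Moser for drift–diffusion at the axis (KNSS,
Chen–Strain–Tsai–Yau arXiv:0709.4230, Seregin–Šverák SereginSverak2009, LRT) + vorticity kinematics;
nothing from averaged/abstract bilinear theory.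

RANKED CRUXES. #2 TiltDomination (crux) — Let v be a Type-I ancient Oseen-mild divergence-free
profile on (−∞,0)×ℝ³, suitable on the backward slab with 𝐈 < ∞, with ⟪curl v, e₃⟫ ≥ 0 everywhere and
linear ball growth of ⟪curl v, e₃⟫, backward singular at (0,0). Then it is TILT-DOMINATED about its
singular axis on the unit cylinder: there are K, M ≥ 0 with ∮_(S(r,z)) |ω − ω₃e₃| dl ≤ K ∮_(S(r,z))
ω₃ dl + M·r for every horizontal circle S(r,z) = {(r cos θ, r sin θ, z)} with 0<r<1, |z|<1 and every
−1<s<0. (Assume-the-opposite content: the counterexample must twist about its own axis at all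
scales.) [deps: FilamentaryGrowth, SuitableHalfSpaceZoom] [difficulty: XL] (why it might fail: the
−2-homogeneous far-field vorticity of a Type-I profile may be horizontal on a cone of directions
where the ω₃-tail vanishes, so ∮|ω_h| ≫ ∮ω₃ + Mr on circles with √(−s) ≪ r < 1 as s→0⁻; or the core
itself folds (LRT's twisting scenario).) [arXiv:2501.08976, arXiv:0709.3599, arXiv:1811.00502]
#3 AveragedConeLiouville (crux) — (the transferred theorem) A Type-I ancient Oseen-mild
divergence-free profile, suitable on the backward slab with 𝐈 < ∞, with ⟪curl v, e₃⟫ ≥ 0 everywhere,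
which is tilt-dominated about the vertical axis on the unit cylinder (∃ K, M ≥ 0 as above), is NOT
backward singular at (0,0). Mechanism: the axis circulation Γ(r,z,s) ≥ 0 solves the circle-averaged
KNSS swirl equation whose remainder is, under tilt domination and the sign, an
almost-divergence-free Type-I drift term; Lei–Ren–Tian's De Giorgi decay of the vorticity flux at
the axis (their §4, written for circle/disc fluxes) plus ε-regularity gives regularity of the apex.
[difficulty: L] (why it might fail: LRT's De Giorgi iteration may use the pointwise cone bound
inside quadratic (energy-level) terms where circle-averaged L¹ control of |ω_h| does not close, and
the slack M·r must be absorbed by ε-regularity at the apex rather than scaled away as in their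
blow-up argument.) [arXiv:2501.08976, arXiv:0709.3599, arXiv:0709.4230, SereginSverak2009]
#4 FilamentaryGrowth (crux) — (shared verbatim with FilamentPinchDoor =
stmt-NavierStokesRegularity-26431) in the energy class, non-negativity of ⟪curl v, e⟫ forces linear
ball growth ∫_(B_R(x)) ⟪curl v(s), e⟫ ≤ K·R (cutoff + curl integration by parts + slice Morrey bound
2𝐈r). Feeds TiltDomination's growth hypothesis (with e = e₃). [difficulty: M] (why it might fail:
the slice Morrey bound from 𝐈 is an a.e.-in-time statement (cknAEss); upgrading to every s<0 needs
L²_loc-continuity of slices from the mild class, and K must not degrade as s→0⁻ — a bookkeeping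
risk, not a mathematical one.) [arXiv:1811.00502, CaffarelliKohnNirenberg1982]
#9 SuitableHalfSpaceZoom (support) — (shared verbatim with FilamentPinchDoor =
stmt-NavierStokesRegularity-26432) energy-class half-space zoom: under the leaf's hypotheses and ¬
backward bounded at (x₀,T), rescaling about x₀ yields a Type-I ancient Oseen-mild divergence-free
profile, suitable on the backward slab with a weak gradient and 𝐈 < ∞, backward singular at (0,0),
with ⟪curl v(s) y, e⟫ ≥ 0 everywhere. [difficulty: M] [arXiv:1811.00502, SereginSverak2009,
arXiv:0709.3599]
#9 RotationToAxis (support) — Rotation covariance (plumbing): if no profile of the class with ⟪curl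
v, e₃⟫ ≥ 0 and linear e₃-ball growth is backward singular at (0,0), then the same holds with e₃
replaced by any e ≠ 0 (conjugate v, π, H by the rotation taking e/‖e‖ to e₃; heatExtension,
oseenDuhamel, curl, IsDivFree, suitability, typeIBound and IsBackwardSingularPoint are
rotation-covariant, ball growth rescales K by ‖e‖). [difficulty: M] [arXiv:1811.00502]

TWO-LAYER PLAN. AveragedConeLiouville ⇐ (CircleSwirlIdentity: Γ solves ∂ₛΓ + v̄ᵣ∂ᵣΓ + v̄_z∂_zΓ =
∂ᵣᵣΓ − r⁻¹∂ᵣΓ + ∂_zzΓ + ℛ with ∂ᵣΓ = ∮ω₃ dl, classical on slices — M–L, provable) →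
(ConeLiouvilleGivenSwirl: LRT §4 De Giorgi decay at the axis for that equation with
almost-divergence-free Type-I drift + ε-regularity — L); TiltDomination ⇐ (NeckLength: circulation ≥
c on ρ₀<r<R at the heights of a set Z costs ∫_(B_R)|v(s)|² ≥ c²|Z|log(R/ρ₀)/2π ≤ 2𝐈R — M, provable)
→ (SlackAwayFromApex: for s ≤ −δ the class bound |ω(s)| ≤ c(−s)⁻¹ makes every circle slack-covered —
M, provable) → (ApexTiltOfNeck: tilt domination in the collar −δ<s<0 for the neck — XL). k = 2 and
3; both skeletons ship at birth (BC3), the glued splits are filed only when a prover asks.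

KILL CRITERIA. An explicit Type-I ancient mild suitable profile with ω₃ ≥ 0, backward singular at
the apex, refutes TiltDomination∘AveragedConeLiouville jointly; one that is moreover tilt-dominated
refutes AveragedConeLiouville alone and closes the route (refuted:AveragedConeLiouville); a
one-signed singular profile violating tilt domination refutes TiltDomination (route closed
refuted:TiltDomination, and the twisting counterexample becomes the programme's object). A proof
that LRT's §4 genuinely needs the pointwise cone in an energy term (not repairable by circle
averages) retires AveragedConeLiouville as typed (restate with an L²-averaged cone).
FilamentaryGrowth/SuitableHalfSpaceZoom are shared with FilamentPinchDoor and die with it if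
mis-typed.

NOT DECOMPOSED YET. The circle-averaged swirl identity, the De Giorgi decay at the axis, the
ε-regularity step absorbing the slack M, the neck-length lemma and the collar restriction are
layer-2 children (named above) carried by the birth skeletons, not items; the identification of
limits inside SuitableHalfSpaceZoom is internal to that support item (host mechanics,
FilamentPinchDoor).

CHEAPEST FALSIFIER. Compute the tilt ratio τ(r,z,s) = ∮_(S(r,z))|ω_h| dl / (∮_(S(r,z))ω₃ dl + r) on
explicit one-signed fields: (a) Burgers/Lamb–Oseen columnar vortex along e₃ (τ ≡ 0 ✓), (b) a TILTED
columnar vortex (axis e₃cosα + e₁sinα, still ω₃ ≥ 0): about the WRONG axis τ ~ tanα·(1 + r/core) is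
unbounded as the core shrinks — so TiltDomination is only plausible about the profile's own singular
axis, which is why the crux fixes the axis through the singular point and the rotation support
aligns e; (c) a helical (twisted) filament with pitch p: τ ≈ 2πr_core/p bounded ✓ unless the pitch
shrinks with the core (p ~ √(−s)): THAT is the twisting counterexample the crux must exclude — a
refuter's first instrument row is «helical Type-I filament with parabolic pitch: is it Oseen-mild
Type-I ancient?». In Lean: the BC7 tautology probe on both new cruxes (run: CLEAN) and the C→S
probes (fail).

NUMBERS. Γ(r,z,s) ≤ 2πr·C(−s)^(−1/2) (Type-I), so Γ ≤ 2πC on the parabolic region r ≤ √(−s); slice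
Morrey ∫_(B_R)|v(s)|² ≤ 2𝐈R; neck-length bound |{z : |z|<R/2, Γ(√(−s),z,s) ≥ c}| ≤ 4π𝐈R/(c²
log(R/√(−s))); class vorticity bound |ω(s)| ≤ c₁N²(−s)⁻¹ (tree p595330
`CoriolisHead.exists_norm_iteratedFDeriv_le_of_ancient_typeI`), so SlackAwayFromApex holds with M_δ
= 2πc₁N²/δ.

DEFINITION REQUESTS. None: every statement is over existing declarations (`curl`,
`EuclideanSpace.single`, `WithLp.toLp`, interval integrals, `HasTypeITimeDecay`, `oseenDuhamel`,
`heatExtension`, `IsDivFree`, `IsSuitableWeakSolutionOn`, `slab`, `HasWeakSpatialGradientOn`,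
`typeIBound`, `IsBackwardSingularPoint`, `IsBackwardBoundedAt`); the circle functionals are inlined
(`∫ θ in 0..2π, … (WithLp.toLp 2 ![r cos θ, r sin θ, z]) … * r`). No mint: the leaf
LocalTubeDoorHalfSpace is registered.

Novelty: Searches (2026-08-28): rg over the NS Theses for `Real.cos θ|intervalIntegral|circulation|swirl`
(axis-circulation functionals appear in NO route; the axisymmetric routes use `r v_θ` only under
symmetry hypotheses; the two routes on this leaf — HalfSpaceWindowDoor (windowed planar flux law +
layer exclusion, time class) and FilamentPinchDoor (energy class, far-field flux freezing + pinch
exclusion) — both end in 19708); lit search --hybrid "vorticity flux through discs circulation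
non-axisymmetric swirl equation Navier-Stokes regularity cone condition" (8 docs, textbooks only:
Majda–Bertozzi, Frisch, Davidson, Lemarié-Rieusset p.302) and lit vsearch of the circle-averaged
swirl identity (textbooks only) — no hits for the identity or an averaged cone condition in
corpus(fts+vec); lit galaxy search "absolute vorticity flux|local vorticity flux|averaged swirl",
"circulation around circles|circle-averaged|azimuthally averaged swirl", "vorticity direction|double
cone|half-space vorticity" --star pdf (engineering noise only) — no hits in galaxy.
Nearest prior art found: Lei–Ren–Tian arXiv:2501.08976 (Thm 1.1: pointwise double cone ⇒ regular,
via local vorticity fluxes through discs D(r,z,t)/circles S(r,z,t) about the axis and De Giorgi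
decay; Rem 1.3: half-space open) [corpus:paper:arxiv-2501.08976 p.4–5]; KNSS arXiv:0709.3599
(axisymmetric Γ-Liouville); Chen–Strain–Tsai–Yau arXiv:0709.4230; in tree
FilamentPinchDoor/HalfSpaceWindowDoor (same leaf, different levers, both through 19  [refs: 2501.08976, 0709.3599, 0709.4230, paper:arxiv-2501.08976]

Barriers (technique_class: blow-up-zoom, vorticity-sign, circulation, de-giorgi): - technique_class: blow-up-zoom, vorticity-sign, circulation, de-giorgi
- Literature.Barriers.NavierStokesRegularity.AveragedTypeIBlowup: outside its class — both new
cruxes use the exact vorticity transport structure (the swirl identity needs div ω = 0, the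
conservative form of the vorticity equation and Stokes on discs; sign preservation and circulation
are false for Tao-averaged bilinear forms).
- Literature.Barriers.NavierStokesRegularity.EnergySupercriticality: evaded by hypothesis —
everything is scale-invariant (Type-I door, 𝐈, K, tilt ratio dimensionless; the unit cylinder is the
local picture of LRT's theorem, not a supercritical quantity).
- Literature.Barriers.NavierStokesRegularity.NavierStokesInequalitySingularSolution: Scheffer-type
NSI solutions are suitable with finite scaled energies, so AveragedConeLiouville cannot follow from
the local energy inequality alone; it is required to use the equation (Oseen-mild identity,
vorticity equation via the swirl identity) — exactly as LRT's proof does; the bet is that the flux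
structure, not the inequality, decides.
- Literature.Barriers.NavierStokesRegularity.VorticityStrainNonlocality: not beaten head-on by
TiltDomination; the bet is that for a one-signed NECK (energy class) the strain needed for Type-I
concentration cannot also rotate Type-I-strong vorticity to horizontal on circles about the axis at
every scale — the residual XL content, declared as such; AveragedConeLiouville sidesteps it the way
LRT do (the cone hy

History (route lifecycle, newest last):
- 2026-08-28T08:42:06Z · rev 1: restated Assembly (stmt-NavierStokesRegularity-26891) — critic-of-record idea-crit-4 P2 (2026-08-28T08:15:55Z): localise the research crux — TiltDominationLoc (stmt-26991, ∃δ parabolic neighbourhood of the apex; stri (planner-ns-idea-6-g3-0)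
- 2026-08-28T08:43:19Z · rev 2: dropped TiltDomination — drop TiltDomination (stmt-26888): superseded by the strictly weaker localised crux TiltDominationLoc (stmt-26991) + support ScalingToUnit (stmt-26992) per criti (planner-ns-idea-6-g3-0)

sub-problem: NavierStokesRegularity · status: open · opened planner-ns-idea-6-g3-0 2026-08-28T08:04:17Z · rev 2 · ledger route-NavierStokesRegularity-AxisTwistDoor
GENERATED by the gate from the ledger (D-0016/17). Provers cite these decls: `theorem foo : Summit.NavierStokesRegularity.NavierStokesRegularity.Theses.AxisTwistDoor.<Decl> := …` in Summits/NavierStokesRegularity/NavierStokesRegularity/Theorems/<Name>.lean.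
-/

namespace Summit.NavierStokesRegularity.NavierStokesRegularity.Theses.AxisTwistDoor

open scoped BigOperators Topology Manifold Classical MeasureTheory ProbabilityTheory Matrix InnerProductSpace ComplexConjugate ContinuousMap
open Filter Set Function TopologicalSpace MeasureTheory

attribute [summit_statement] _root_.NavierStokesRegularity
attribute [summit_statement] _root_.Summit.NavierStokesRegularity.NavierStokesRegularity.Theses.HalfSpaceWindowDoor.Target

open Literature.NS

/-- item stmt-NavierStokesRegularity-26991 · crux · rank 2 · open · by planner
[crux] (rank 2, XL, research; LOCALISED form of TiltDomination per critic-of-record idea-crit-4 P2,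
2026-08-28) For an energy-class Type-I ancient Oseen-mild profile (suitable, weak gradient, A–B
typeIBound < ⊤) with one-signed vertical vorticity ⟪curl v, e₃⟫ ≥ 0 and filamentary (linear-in-R)
growth of its signed ball mass, backward-singular at the origin: on SOME parabolic neighbourhood
{−δ² < s < 0, 0 < r < δ, |z| < δ} of the apex the circle-integrated horizontal vorticity is
dominated by the circle-integrated vertical vorticity plus a decaying slack, ∮|ω_h| dl ≤ K ∮ω₃ dl +
M r (averaged Lei–Ren–Tian double cone about the axis through the apex). Strictly weaker than the
unit-cylinder TiltDomination (δ = 1), same sufficiency via ScalingToUnit. Why it might fail: a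
backward-singular one-signed profile whose apex neck twists (|ω_h| ≫ ω₃ on axis circles at r ~
√(−s)), or whose self-similar tail director violates the averaged cone on an open set of directions
(slack M·r cannot absorb r⁻¹), or whose vorticity is planar (ω₃ ≡ 0) on a parabolic neighbourhood of
the apex while singular there (void-lever branch = local planar-vorticity Liouville, stub 0).
Sources: arXiv:2501.08976 (Lei–Ren -/
@[route_item "route-NavierStokesRegularity-AxisTwistDoor", crux]
def TiltDominationLoc : Prop :=
  ∀ (C : ℝ) (v : ℝ → EuclideanSpace ℝ (Fin 3) → EuclideanSpace ℝ (Fin 3)) (π : ℝ → EuclideanSpace ℝ (Fin 3) → ℝ) (H : ℝ → EuclideanSpace ℝ (Fin 3) → EuclideanSpace ℝ (Fin 3) →L[ℝ] EuclideanSpace ℝ (Fin 3)), Literature.Analysis.FluidPDE.HasTypeITimeDecay C v → ContinuousOn (Function.uncurry v) (Set.Iio (0 : ℝ) ×ˢ Set.univ) → (∀ s t : ℝ, s < t → t < 0 → ∀ x, v t x = Literature.Analysis.UnboundedOperators.heatExtension (v s) (t - s) x - Literature.Analysis.FluidPDE.oseenDuhamel 1 s v v t x) → (∀ t < 0, Literature.Analysis.FluidPDE.VectorCalculus.IsDivFree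 (v t)) → Literature.Analysis.FluidPDE.IsSuitableWeakSolutionOn (Literature.Analysis.FluidPDE.slab (EuclideanSpace ℝ (Fin 3)) (Set.Iio (0 : ℝ)) isOpen_Iio) 1 0 v π → Literature.Analysis.FluidPDE.HasWeakSpatialGradientOn (Literature.Analysis.FluidPDE.slab (EuclideanSpace ℝ (Fin 3)) (Set.Iio (0 : ℝ)) isOpen_Iio) v H → Literature.Analysis.FluidPDE.typeIBound (Set.Iio (0 : ℝ) ×ˢ Set.univ) v π H < ⊤ → (∀ s < 0, ∀ y, 0 ≤ ⟪Literature.Analysis.FluidPDE.curl (v s) y, (EuclideanSpace.single (2 : Fin 3) (1 : ℝ))⟫_ℝ) → (∃ K : ℝ, ∀ s < 0, ∀ (x : EuclideanSpace ℝ (Fin 3)) (R : ℝ), 0 < R → ∫⁻ y in Metric.ball x R, ENNReal.ofReal ⟪Literature.Analysis.FluidPDE.curl (v s) y, (EuclideanSpace.single (2 : Fin 3) (1 : ℝ))⟫_ℝ ≤ ENNReal.ofReal (K * R)) → Literature.Analysis.FluidPDE.IsBackwardSingularPoint v 0 → ∃ δ K M : ℝ, 0 < δ ∧ 0 ≤ K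 ∧ 0 ≤ M ∧ ∀ s : ℝ, -δ ^ 2 < s → s < 0 → ∀ r : ℝ, 0 < r → r < δ → ∀ z : ℝ, |z| < δ → ∫ θ in (0 : ℝ)..(2 * Real.pi), ‖Literature.Analysis.FluidPDE.curl (v s) (WithLp.toLp 2 ![r * Real.cos θ, r * Real.sin θ, z] : EuclideanSpace ℝ (Fin 3)) - ⟪Literature.Analysis.FluidPDE.curl (v s) (WithLp.toLp 2 ![r * Real.cos θ, r * Real.sin θ, z] : EuclideanSpace ℝ (Fin 3)), (EuclideanSpace.single (2 : Fin 3) (1 : ℝ))⟫_ℝ • (EuclideanSpace.single (2 : Fin 3) (1 : ℝ))‖ * r ≤ K * (∫ θ in (0 : ℝ)..(2 * Real.pi), ⟪Literature.Analysis.FluidPDE.curl (v s) (WithLp.toLp 2 ![r * Real.cos θ, r * Real.sin θ, z] : EuclideanSpace ℝ (Fin 3)), (EuclideanSpace.single (2 : Fin 3) (1 : ℝ))⟫_ℝ * r) + M * r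

/-- item stmt-NavierStokesRegularity-26889 · crux · rank 3 · closed · proved by Summit.NavierStokesRegularity.NavierStokesRegularity.Theorems.AxisTwistDoorAveragedConeLiouvilleHolds.AveragedConeLiouville_holds (prover) · by planner
why it might fail: LRT's De Giorgi iteration may use the pointwise cone bound inside quadratic (energy-level) terms where circle-averaged L¹ control of |ω_h| does not close, and the slack M·r must be absorbed by ε-regularity at the apex rather than scaled away as in their blow-up argument.
sources: arXiv:2501.08976, arXiv:0709.3599, arXiv:0709.4230, SereginSverak2009
[crux] (the transferred theorem) A Type-I ancient Oseen-mild divergence-free profile, suitable on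
the backward slab with 𝐈 < ∞, with ⟪curl v, e₃⟫ ≥ 0 everywhere, which is tilt-dominated about the
vertical axis on the unit cylinder (∃ K, M ≥ 0 as above), is NOT backward singular at (0,0).
Mechanism: the axis circulation Γ(r,z,s) ≥ 0 solves the circle-averaged KNSS swirl equation whose
remainder is, under tilt domination and the sign, an almost-divergence-free Type-I drift term;
Lei–Ren–Tian's De Giorgi decay of the vorticity flux at the axis (their §4, written for circle/disc
fluxes) plus ε-regularity gives regularity of the apex. [difficulty: L] -/
@[route_item "route-NavierStokesRegularity-AxisTwistDoor", crux]
def AveragedConeLiouville : Prop :=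
  ∀ (C : ℝ) (v : ℝ → EuclideanSpace ℝ (Fin 3) → EuclideanSpace ℝ (Fin 3)) (π : ℝ → EuclideanSpace ℝ (Fin 3) → ℝ) (H : ℝ → EuclideanSpace ℝ (Fin 3) → EuclideanSpace ℝ (Fin 3) →L[ℝ] EuclideanSpace ℝ (Fin 3)), Literature.Analysis.FluidPDE.HasTypeITimeDecay C v → ContinuousOn (Function.uncurry v) (Set.Iio (0 : ℝ) ×ˢ Set.univ) → (∀ s t : ℝ, s < t → t < 0 → ∀ x, v t x = Literature.Analysis.UnboundedOperators.heatExtension (v s) (t - s) x - Literature.Analysis.FluidPDE.oseenDuhamel 1 s v v t x) → (∀ t < 0, Literature.Analysis.FluidPDE.VectorCalculus.IsDivFree (v t)) → Literature.Analysis.FluidPDE.IsSuitableWeakSolutionOn (Literature.Analysis.FluidPDE.slab (EuclideanSpace ℝ (Fin 3)) (Set.Iio (0 : ℝ)) isOpen_Iio) 1 0 v π → Literature.Analysis.FluidPDE.HasWeakSpatialGradientOn (Literature.Analysis.FluidPDE.slab (EuclideanSpace ℝ (Fin 3)) (Set.Iio (0 : ℝ)) isOpen_Iio) v H → Literature.Analysis.FluidPDE.typeIBound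 (Set.Iio (0 : ℝ) ×ˢ Set.univ) v π H < ⊤ → (∀ s < 0, ∀ y, 0 ≤ ⟪Literature.Analysis.FluidPDE.curl (v s) y, (EuclideanSpace.single (2 : Fin 3) (1 : ℝ))⟫_ℝ) → (∃ K M : ℝ, 0 ≤ K ∧ 0 ≤ M ∧ ∀ s : ℝ, -1 < s → s < 0 → ∀ r : ℝ, 0 < r → r < 1 → ∀ z : ℝ, |z| < 1 → ∫ θ in (0 : ℝ)..(2 * Real.pi), ‖Literature.Analysis.FluidPDE.curl (v s) (WithLp.toLp 2 ![r * Real.cos θ, r * Real.sin θ, z] : EuclideanSpace ℝ (Fin 3)) - ⟪Literature.Analysis.FluidPDE.curl (v s) (WithLp.toLp 2 ![r * Real.cos θ, r * Real.sin θ, z] : EuclideanSpace ℝ (Fin 3)), (EuclideanSpace.single (2 : Fin 3) (1 : ℝ))⟫_ℝ • (EuclideanSpace.single (2 : Fin 3) (1 : ℝ))‖ * r ≤ K * (∫ θ in (0 : ℝ)..(2 * Real.pi), ⟪Literature.Analysis.FluidPDE.curl (v s) (WithLp.toLp 2 ![r * Real.cos θ, r * Real.sin θ, z] : EuclideanSpace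 ℝ (Fin 3)), (EuclideanSpace.single (2 : Fin 3) (1 : ℝ))⟫_ℝ * r) + M * r) → ¬ Literature.Analysis.FluidPDE.IsBackwardSingularPoint v 0

-- `AveragedConeLiouville` holds: proved by `Summit.NavierStokesRegularity.NavierStokesRegularity.Theorems.AxisTwistDoorAveragedConeLiouvilleHolds.AveragedConeLiouville_holds` (its module imports this route file, so no `_holds` link can be stated here).

/-- item stmt-NavierStokesRegularity-26431 · crux · rank 4 · closed · proved by Summit.NavierStokesRegularity.NavierStokesRegularity.Theorems.axisTwistDoor_filamentaryGrowth_proof (prover) · by planner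
why it might fail: the slice Morrey bound from 𝐈 is an a.e.-in-time statement (cknAEss); upgrading to every s<0 needs L²_loc-continuity of slices from the mild class, and K must not degrade as s→0⁻ — a bookkeeping risk, not a mathematical one.
sources: arXiv:1811.00502, CaffarelliKohnNirenberg1982
[crux] In the same energy class, non-negativity of ⟪curl v, e⟫ alone forces FILAMENTARY growth:
there is K with ∫_(B_R(x)) ⟪curl v(s), e⟫ ≤ K·R for every s<0, centre x and radius R>0 (K =
c·‖e‖·√𝐈: cutoff test function, curl integrated by parts onto the cutoff, Cauchy–Schwarz, slice
Morrey bound ∫_(B_r)|v(s)|² ≤ 2𝐈r). The assume-the-opposite structural lemma: the counterexample's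
signed vorticity lives on a set of 1-dimensional growth, uniformly in time; layers and volumes are
impossible. [difficulty: M] -/
@[route_item "route-NavierStokesRegularity-AxisTwistDoor", crux]
def FilamentaryGrowth : Prop :=
  ∀ (C : ℝ) (v : ℝ → EuclideanSpace ℝ (Fin 3) → EuclideanSpace ℝ (Fin 3)) (π : ℝ → EuclideanSpace ℝ (Fin 3) → ℝ) (H : ℝ → EuclideanSpace ℝ (Fin 3) → EuclideanSpace ℝ (Fin 3) →L[ℝ] EuclideanSpace ℝ (Fin 3)), Literature.Analysis.FluidPDE.HasTypeITimeDecay C v → ContinuousOn (Function.uncurry v) (Set.Iio (0 : ℝ) ×ˢ Set.univ) → (∀ s t : ℝ, s < t → t < 0 → ∀ x, v t x = Literature.Analysis.UnboundedOperators.heatExtension (v s) (t - s) x - Literature.Analysis.FluidPDE.oseenDuhamel 1 s v v t x) → (∀ t < 0, Literature.Analysis.FluidPDE.VectorCalculus.IsDivFree (v t)) → Literature.Analysis.FluidPDE.IsSuitableWeakSolutionOn (Literature.Analysis.FluidPDE.slab (EuclideanSpace ℝ (Fin 3)) (Set.Iio (0 : ℝ)) isOpen_Iio) 1 0 v π → Literature.Analysis.FluidPDE.HasWeakSpatialGradientOn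 (Literature.Analysis.FluidPDE.slab (EuclideanSpace ℝ (Fin 3)) (Set.Iio (0 : ℝ)) isOpen_Iio) v H → Literature.Analysis.FluidPDE.typeIBound (Set.Iio (0 : ℝ) ×ˢ Set.univ) v π H < ⊤ → ∀ (e : EuclideanSpace ℝ (Fin 3)), e ≠ 0 → (∀ s < 0, ∀ y, 0 ≤ ⟪Literature.Analysis.FluidPDE.curl (v s) y, e⟫_ℝ) → ∃ K : ℝ, ∀ s < 0, ∀ (x : EuclideanSpace ℝ (Fin 3)) (R : ℝ), 0 < R → ∫⁻ y in Metric.ball x R, ENNReal.ofReal ⟪Literature.Analysis.FluidPDE.curl (v s) y, e⟫_ℝ ≤ ENNReal.ofReal (K * R)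

-- `FilamentaryGrowth` holds: proved by `Summit.NavierStokesRegularity.NavierStokesRegularity.Theorems.axisTwistDoor_filamentaryGrowth_proof` (its module imports this route file, so no `_holds` link can be stated here).

/-- item stmt-NavierStokesRegularity-26432 · support · rank 9 · closed · proved by Summit.NavierStokesRegularity.NavierStokesRegularity.Theorems.filamentPinchDoor_suitableHalfSpaceZoom_proof (prover) · by planner
sources: arXiv:1811.00502, SereginSverak2009, arXiv:0709.3599
[support] Energy-class half-space zoom: under the leaf's frame hypotheses, the door hypothesis and ¬
backward bounded at (x₀,T), rescaling about x₀ along λ_j→0 yields a profile that is Type-I in time,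
continuous, Oseen-mild and divergence-free (the host's HalfSpaceZoom, CLOSED as stmt-25312) AND a
suitable weak solution on the backward slab with a weak spatial gradient and 𝐈 < ∞ (weak-Serrin rate
lemma for u on Q((T,x₀),ρ) + Albritton–Barker/Seregin extraction along the same scales, limits
identified a.e.), backward singular at (0,0), with ⟪curl v(s) y, e⟫ ≥ 0 everywhere. [difficulty: M] -/
@[route_item "route-NavierStokesRegularity-AxisTwistDoor", crux]
def SuitableHalfSpaceZoom : Prop :=
  ∀ (ν T : ℝ), 0 < ν → 0 < T → ∀ (u : ℝ → EuclideanSpace ℝ (Fin 3) → EuclideanSpace ℝ (Fin 3)) (p : ℝ → EuclideanSpace ℝ (Fin 3) → ℝ), Literature.Analysis.FluidPDE.IsClassicalNSSolutionOn (Set.Ico 0 T) ν 0 u p → Literature.Analysis.FluidPDE.IsLerayHopfOn T ν 0 (u 0) u → Literature.Analysis.FluidPDE.HasRapidSpatialDecay (u 0) → ∀ (x₀ : EuclideanSpace ℝ (Fin 3)) (ρ M : ℝ), 0 < ρ → (∀ t ∈ Set.Ico 0 T, T - ρ ^ 2 < t → ∀ x ∈ Metric.ball x₀ ρ, ‖u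 t x‖ * Real.sqrt (ν * (T - t)) ≤ M) → ∀ (e : EuclideanSpace ℝ (Fin 3)), e ≠ 0 → (∀ R : ℝ, 0 < R → Filter.Tendsto (fun t => ∫⁻ y in Metric.ball (0 : EuclideanSpace ℝ (Fin 3)) R, ENNReal.ofReal ((min (⟪(T - t) • Literature.Analysis.FluidPDE.curl (u t) (x₀ + Real.sqrt (T - t) • y), e⟫_ℝ) 0) ^ 2)) (nhdsWithin T (Set.Iio T)) (nhds 0)) → ¬ Literature.Analysis.FluidPDE.IsBackwardBoundedAt u T x₀ → ∃ (C : ℝ) (v : ℝ → EuclideanSpace ℝ (Fin 3) → EuclideanSpace ℝ (Fin 3)) (π : ℝ → EuclideanSpace ℝ (Fin 3) → ℝ) (H : ℝ → EuclideanSpace ℝ (Fin 3) → EuclideanSpace ℝ (Fin 3) →L[ℝ] EuclideanSpace ℝ (Fin 3)), (Literature.Analysis.FluidPDE.HasTypeITimeDecay C v ∧ ContinuousOn (Function.uncurry v) (Set.Iio (0 : ℝ) ×ˢ Set.univ) ∧ (∀ s t : ℝ, s < t → t < 0 → ∀ x, v t x = Literature.Analysis.UnboundedOperators.heatExtension (v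 s) (t - s) x - Literature.Analysis.FluidPDE.oseenDuhamel 1 s v v t x) ∧ (∀ t < 0, Literature.Analysis.FluidPDE.VectorCalculus.IsDivFree (v t))) ∧ (Literature.Analysis.FluidPDE.IsSuitableWeakSolutionOn (Literature.Analysis.FluidPDE.slab (EuclideanSpace ℝ (Fin 3)) (Set.Iio (0 : ℝ)) isOpen_Iio) 1 0 v π ∧ Literature.Analysis.FluidPDE.HasWeakSpatialGradientOn (Literature.Analysis.FluidPDE.slab (EuclideanSpace ℝ (Fin 3)) (Set.Iio (0 : ℝ)) isOpen_Iio) v H ∧ Literature.Analysis.FluidPDE.typeIBound (Set.Iio (0 : ℝ) ×ˢ Set.univ) v π H < ⊤) ∧ Literature.Analysis.FluidPDE.IsBackwardSingularPoint v 0 ∧ ∀ s < 0, ∀ y, 0 ≤ ⟪Literature.Analysis.FluidPDE.curl (v s) y, e⟫_ℝ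

/-- `SuitableHalfSpaceZoom` holds: proved by `Summit.NavierStokesRegularity.NavierStokesRegularity.Theorems.filamentPinchDoor_suitableHalfSpaceZoom_proof`. -/
theorem SuitableHalfSpaceZoom_holds : SuitableHalfSpaceZoom := _root_.Summit.NavierStokesRegularity.NavierStokesRegularity.Theorems.filamentPinchDoor_suitableHalfSpaceZoom_proof

/-- item stmt-NavierStokesRegularity-26890 · support · rank 9 · closed · proved by Summit.NavierStokesRegularity.NavierStokesRegularity.Theorems.AxisTwistDoorRotationToAxis.rotationToAxis_proof (prover) · by planner
sources: arXiv:1811.00502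
[support] Rotation covariance (plumbing): if no profile of the class with ⟪curl v, e₃⟫ ≥ 0 and
linear e₃-ball growth is backward singular at (0,0), then the same holds with e₃ replaced by any e ≠
0 (conjugate v, π, H by the rotation taking e/‖e‖ to e₃; heatExtension, oseenDuhamel, curl,
IsDivFree, suitability, typeIBound and IsBackwardSingularPoint are rotation-covariant, ball growth
rescales K by ‖e‖). [difficulty: M] -/
@[route_item "route-NavierStokesRegularity-AxisTwistDoor", crux]
def RotationToAxis : Prop :=
  (∀ (C : ℝ) (v : ℝ → EuclideanSpace ℝ (Fin 3) → EuclideanSpace ℝ (Fin 3)) (π : ℝ → EuclideanSpace ℝ (Fin 3) → ℝ) (H : ℝ → EuclideanSpace ℝ (Fin 3) → EuclideanSpace ℝ (Fin 3) →L[ℝ] EuclideanSpace ℝ (Fin 3)), Literature.Analysis.FluidPDE.HasTypeITimeDecay C v → ContinuousOn (Function.uncurry v) (Set.Iio (0 : ℝ) ×ˢ Set.univ) → (∀ s t : ℝ, s < t → t < 0 → ∀ x, v t x = Literature.Analysis.UnboundedOperators.heatExtension (v s) (t - s) x - Literature.Analysis.FluidPDE.oseenDuhamel 1 s v v t x) →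 (∀ t < 0, Literature.Analysis.FluidPDE.VectorCalculus.IsDivFree (v t)) → Literature.Analysis.FluidPDE.IsSuitableWeakSolutionOn (Literature.Analysis.FluidPDE.slab (EuclideanSpace ℝ (Fin 3)) (Set.Iio (0 : ℝ)) isOpen_Iio) 1 0 v π → Literature.Analysis.FluidPDE.HasWeakSpatialGradientOn (Literature.Analysis.FluidPDE.slab (EuclideanSpace ℝ (Fin 3)) (Set.Iio (0 : ℝ)) isOpen_Iio) v H → Literature.Analysis.FluidPDE.typeIBound (Set.Iio (0 : ℝ) ×ˢ Set.univ) v π H < ⊤ → (∀ s < 0, ∀ y, 0 ≤ ⟪Literature.Analysis.FluidPDE.curl (v s) y, (EuclideanSpace.single (2 : Fin 3) (1 : ℝ))⟫_ℝ) → (∃ K : ℝ, ∀ s < 0, ∀ (x : EuclideanSpace ℝ (Fin 3)) (R : ℝ), 0 < R → ∫⁻ y in Metric.ball x R, ENNReal.ofReal ⟪Literature.Analysis.FluidPDE.curl (v s) y, (EuclideanSpace.single (2 : Fin 3) (1 : ℝ))⟫_ℝ ≤ ENNReal.ofReal (K * R)) → ¬ Literature.Analysis.FluidPDE.IsBackwardSingularPoint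 v 0) → ∀ (e : EuclideanSpace ℝ (Fin 3)), e ≠ 0 → ∀ (C : ℝ) (v : ℝ → EuclideanSpace ℝ (Fin 3) → EuclideanSpace ℝ (Fin 3)) (π : ℝ → EuclideanSpace ℝ (Fin 3) → ℝ) (H : ℝ → EuclideanSpace ℝ (Fin 3) → EuclideanSpace ℝ (Fin 3) →L[ℝ] EuclideanSpace ℝ (Fin 3)), Literature.Analysis.FluidPDE.HasTypeITimeDecay C v → ContinuousOn (Function.uncurry v) (Set.Iio (0 : ℝ) ×ˢ Set.univ) → (∀ s t : ℝ, s < t → t < 0 → ∀ x, v t x = Literature.Analysis.UnboundedOperators.heatExtension (v s) (t - s) x - Literature.Analysis.FluidPDE.oseenDuhamel 1 s v v t x) → (∀ t < 0, Literature.Analysis.FluidPDE.VectorCalculus.IsDivFree (v t)) → Literature.Analysis.FluidPDE.IsSuitableWeakSolutionOn (Literature.Analysis.FluidPDE.slab (EuclideanSpace ℝ (Fin 3)) (Set.Iio (0 : ℝ)) isOpen_Iio) 1 0 v π → Literature.Analysis.FluidPDE.HasWeakSpatialGradientOn (Literature.Analysis.FluidPDE.slab (EuclideanSpace ℝ (Fin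 3)) (Set.Iio (0 : ℝ)) isOpen_Iio) v H → Literature.Analysis.FluidPDE.typeIBound (Set.Iio (0 : ℝ) ×ˢ Set.univ) v π H < ⊤ → (∀ s < 0, ∀ y, 0 ≤ ⟪Literature.Analysis.FluidPDE.curl (v s) y, e⟫_ℝ) → (∃ K : ℝ, ∀ s < 0, ∀ (x : EuclideanSpace ℝ (Fin 3)) (R : ℝ), 0 < R → ∫⁻ y in Metric.ball x R, ENNReal.ofReal ⟪Literature.Analysis.FluidPDE.curl (v s) y, e⟫_ℝ ≤ ENNReal.ofReal (K * R)) → ¬ Literature.Analysis.FluidPDE.IsBackwardSingularPoint v 0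

-- `RotationToAxis` holds: proved by `Summit.NavierStokesRegularity.NavierStokesRegularity.Theorems.AxisTwistDoorRotationToAxis.rotationToAxis_proof` (its module imports this route file, so no `_holds` link can be stated here).

/-- item stmt-NavierStokesRegularity-26992 · support · rank 9 · closed · proved by Summit.NavierStokesRegularity.NavierStokesRegularity.Theorems.AxisTwistDoorScalingToUnit.scalingToUnit_proof (operator) · by planner
[support] (rank 9, M; critic-of-record P2/P4 class-plumbing twin of RotationToAxis) PARABOLIC
SCALING TO THE UNIT CYLINDER: the unit-cylinder averaged-cone Liouville theorem
AveragedConeLiouville implies its localised form — if the averaged double cone ∮|ω_h| dl ≤ K∮ω₃ dl +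
M r holds only on {−δ² < s < 0, r < δ, |z| < δ}, apply AveragedConeLiouville to the rescaled profile
nsRescale δ v (s,y) ↦ δ·v(δ²s, δy): the class (HasTypeITimeDecay.nsRescale,
continuousOn_uncurry_nsRescale, mild form via heatExtension/oseenDuhamel scaling, isDivFree,
isSuitableWeakSolutionOn_nsRescale, hasWeakSpatialGradientOn_nsRescale, typeIBound_nsRescale), the
sign (curl_nsRescale: curl of the rescaled slice = δ²·curl v(δ²s)(δ·)), the cone (K invariant, M ↦
Mδ²) and backward singularity at 0 (isBackwardSingularPoint_nsRescale) are all scaling-covariant.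
Routine; every covariance lemma named exists in Literature/Analysis/FluidPDE (SelfSimilar.lean and
the nsRescale family). -/
@[route_item "route-NavierStokesRegularity-AxisTwistDoor", crux]
def ScalingToUnit : Prop :=
  AveragedConeLiouville → ∀ (C : ℝ) (v : ℝ → EuclideanSpace ℝ (Fin 3) → EuclideanSpace ℝ (Fin 3)) (π : ℝ → EuclideanSpace ℝ (Fin 3) → ℝ) (H : ℝ → EuclideanSpace ℝ (Fin 3) → EuclideanSpace ℝ (Fin 3) →L[ℝ] EuclideanSpace ℝ (Fin 3)), Literature.Analysis.FluidPDE.HasTypeITimeDecay C v → ContinuousOn (Function.uncurry v) (Set.Iio (0 : ℝ) ×ˢ Set.univ) → (∀ s t : ℝ, s < t → t < 0 → ∀ x, v t x = Literature.Analysis.UnboundedOperators.heatExtension (v s) (t - s) x - Literature.Analysis.FluidPDE.oseenDuhamel 1 s v v t x) → (∀ t < 0, Literature.Analysis.FluidPDE.VectorCalculus.IsDivFree (v t)) → Literature.Analysis.FluidPDE.IsSuitableWeakSolutionOn (Literature.Analysis.FluidPDE.slab (EuclideanSpace ℝ (Fin 3)) (Set.Iio (0 : ℝ)) isOpen_Iio)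 1 0 v π → Literature.Analysis.FluidPDE.HasWeakSpatialGradientOn (Literature.Analysis.FluidPDE.slab (EuclideanSpace ℝ (Fin 3)) (Set.Iio (0 : ℝ)) isOpen_Iio) v H → Literature.Analysis.FluidPDE.typeIBound (Set.Iio (0 : ℝ) ×ˢ Set.univ) v π H < ⊤ → (∀ s < 0, ∀ y, 0 ≤ ⟪Literature.Analysis.FluidPDE.curl (v s) y, (EuclideanSpace.single (2 : Fin 3) (1 : ℝ))⟫_ℝ) → (∃ δ K M : ℝ, 0 < δ ∧ 0 ≤ K ∧ 0 ≤ M ∧ ∀ s : ℝ, -δ ^ 2 < s → s < 0 → ∀ r : ℝ, 0 < r → r < δ → ∀ z : ℝ, |z| < δ → ∫ θ in (0 : ℝ)..(2 * Real.pi), ‖Literature.Analysis.FluidPDE.curl (v s) (WithLp.toLp 2 ![r * Real.cos θ, r * Real.sin θ, z] : EuclideanSpace ℝ (Fin 3)) - ⟪Literature.Analysis.FluidPDE.curl (v s) (WithLp.toLp 2 ![r * Real.cos θ, r * Real.sin θ, z] : EuclideanSpace ℝ (Fin 3)), (EuclideanSpace.single (2 : Fin 3) (1 : ℝ))⟫_ℝ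 • (EuclideanSpace.single (2 : Fin 3) (1 : ℝ))‖ * r ≤ K * (∫ θ in (0 : ℝ)..(2 * Real.pi), ⟪Literature.Analysis.FluidPDE.curl (v s) (WithLp.toLp 2 ![r * Real.cos θ, r * Real.sin θ, z] : EuclideanSpace ℝ (Fin 3)), (EuclideanSpace.single (2 : Fin 3) (1 : ℝ))⟫_ℝ * r) + M * r) → ¬ Literature.Analysis.FluidPDE.IsBackwardSingularPoint v 0

-- `ScalingToUnit` holds: proved by `Summit.NavierStokesRegularity.NavierStokesRegularity.Theorems.AxisTwistDoorScalingToUnit.scalingToUnit_proof` (its module imports this route file, so no `_holds` link can be stated here).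

-- earlier Assembly (stmt-NavierStokesRegularity-26891, replaced 2026-08-28T08:42:06Z -> stmt-NavierStokesRegularity-26998): retired by None — SuitableHalfSpaceZoom → FilamentaryGrowth → TiltDomination → AveragedConeLiouville → RotationToAxis → Summit.NavierStokesRegularity.NavierStokesRegularity.Theses.HalfSpaceWindowDoor.Target
/-- item stmt-NavierStokesRegularity-26998 · assembly · rank 1 · closed · proved by Summit.NavierStokesRegularity.NavierStokesRegularity.Theorems.axisTwistDoor_assembly_proof (prover) · by planner
sources: arXiv:2501.08976, arXiv:0709.3599
[assembly] pure logic: by contradiction SuitableHalfSpaceZoom gives the profile; FilamentaryGrowth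
its linear signed-mass growth; RotationToAxis reduces the direction e to e₃; TiltDominationLoc gives
the averaged cone on a parabolic neighbourhood of the apex; ScalingToUnit ∘ AveragedConeLiouville
says such a profile is not backward-singular — contradiction. (Chain re-stated 2026-08-28 after
critic-of-record P2: TiltDomination (unit cylinder) superseded by TiltDominationLoc +
ScalingToUnit.) -/
@[route_item "route-NavierStokesRegularity-AxisTwistDoor"]
def Assembly : Prop :=
  SuitableHalfSpaceZoom → FilamentaryGrowth → TiltDominationLoc → AveragedConeLiouville → ScalingToUnit → RotationToAxis → Summit.NavierStokesRegularity.NavierStokesRegularity.Theses.HalfSpaceWindowDoor.Target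

-- `Assembly` holds: proved by `Summit.NavierStokesRegularity.NavierStokesRegularity.Theorems.axisTwistDoor_assembly_proof` (its module imports this route file, so no `_holds` link can be stated here).

/-! D-0027 §2.1 — DECIDING THEOREM (planner-authored via `route open/edit --closes-file`; by planner-ns-idea-6-g3-0 2026-08-28T08:42:06Z):
its hypotheses are this route's items and its conclusion the registered leaf `Summit.NavierStokesRegularity.NavierStokesRegularity.Theses.HalfSpaceWindowDoor.Target` (rung N0-LocalTubeDoorHalfSpace (DOOR), D-0061) (glue_lint), and it elaborates with this file. -/

@[closes "route-NavierStokesRegularity-AxisTwistDoor"] theorem closes (hZ : SuitableHalfSpaceZoom) (hF : FilamentaryGrowth) (hT : TiltDominationLoc)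
    (hA : AveragedConeLiouville) (hS : ScalingToUnit) (hR : RotationToAxis) :
    Summit.NavierStokesRegularity.NavierStokesRegularity.Theses.HalfSpaceWindowDoor.Target := by
  intro ν T hν hT' u p hcl hLH hdec x₀ ρ M hρ hTI e he hfade
  by_contra hbb
  obtain ⟨C, v, π, H, ⟨hdecay, hcont, hmild, hdiv⟩, ⟨hsw, hwg, hI⟩, hsing, hnn⟩ :=
    hZ ν T hν hT' u p hcl hLH hdec x₀ ρ M hρ hTI e he hfade hbb
  have hK := hF C v π H hdecay hcont hmild hdiv hsw hwg hI e he hnn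
  refine hR ?_ e he C v π H hdecay hcont hmild hdiv hsw hwg hI hnn hK hsing
  intro C' v' π' H' hdecay' hcont' hmild' hdiv' hsw' hwg' hI' hnn' hK' hsing'
  exact hS hA C' v' π' H' hdecay' hcont' hmild' hdiv' hsw' hwg' hI' hnn'
    (hT C' v' π' H' hdecay' hcont' hmild' hdiv' hsw' hwg' hI' hnn' hK' hsing') hsing'

end Summit.NavierStokesRegularity.NavierStokesRegularity.Theses.AxisTwistDoor
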